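import Mathlib.Geometry.Manifold.Instances.Real
import Literature.Geometry.Lorentzian.FinalState
import Literature.Geometry.Lorentzian.CauchyDevelopment
import Literature.Geometry.Lorentzian.NullInfinity
import Literature.Geometry.Lorentzian.WeightedNorms
import HarnessLib

/-!
# Named fact: future-complete outgoing null hypersurfaces for LARGE asymptotically Euclidean vacuum
# data (Chruściel 2017, "Long time existence from interior gluing", Thm. 3.1), Cauchy consequence form

Companion of `ExteriorStabilityNullCompleteness.lean` (`klainerman_nicolo_exterior_null_completeness`,
Klainerman–Nicolò 2003: the same conclusion for the strongly asymptotically flat MAXIMAL class with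
four pointwise derivatives), in the SAME conclusion currency (a compact `K ⊆ X` outside whose domain
of influence every normalised future null ray from the data is future complete), for the much larger
weighted-Sobolev class of P. T. Chruściel, *Long time existence from interior gluing*, Class. Quantum
Grav. **34** (2017) 145016 = arXiv:1612.04523 [Chrusciel2017] — NO smallness, NO maximality
`tr k = 0`, `H⁴`-Sobolev decay of any order `α ≥ 1/2`. Requested by the `FinalStateConjecture`
decomposition cell (`decomp-fsc` lens-5 g7 «SobolevLedgerCells», work item `wi-97472`
«port: InfiniteBoostLedger», support S1 of the door `SobolevAccountDoor` of `stmt-29968`).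

## What is printed (held text `paper:arxiv-1612.04523`, chunk:line)

* §2 (p0004:L8–L31), the classes. «We shall say that `(g, K)` on the exterior `E` of a ball in `ℝ³`
  constitutes an `C^{-α}_ℓ`-asymptotically Euclidean end provided there are coordinates in which,
  for all multi-indices `|γ| ≤ ℓ`, `|β| ≤ ℓ−1`, `|∂^γ(g_ij − δ_ij)(x)| = O(|x|^{-|γ|-α})`,
  `|∂^β K_ij(x)| = O(|x|^{-|β|-1-α})` … We say that `(M, g, K)` is `C^{-α}_ℓ`-AE if `M` is the union
  of a compact set and a finite number of ends, all of which are `C^{-α}_ℓ`-AE. An obvious analogue …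
  `W^{-α}_{ℓ,q}`-AE …: in each end `E` we have `g − δ ∈ W^{-α}_{ℓ,q}(E)`, `K ∈ W^{-α-1}_{ℓ-1,q}(E)`.
  Here `u ∈ W^{-α}_{ℓ,q}(E)` if `‖u‖^q := ∑_{|γ| ≤ ℓ} ∫_E |(1+r)^{α+|γ|} ∂^γ u|^q d³x/(1+r)³` is
  finite. We set `H^{-α}_ℓ := W^{-α}_{ℓ,2}`.» «every … end with `α > 1/2` possesses a well-defined
  finite energy-momentum vector `(p₀, p⃗)` … this remains true for `W^{-α}_{ℓ,q}`-AE ends with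
  `α ≥ 1/2` and `qℓ > 3`.»
* §2 (p0004:L54–L62), the parity condition (29IV16.2): «there exists `α₋ > 0` … such that we have
  `|g_ij(x) − g_ij(−x)| + (1+r)|∂_k(g_ij(x) − g_ij(−x))| = O(|x|^{-α₋})`,
  `|K_ij(x) + K_ij(−x)| = O(|x|^{-1-α₋})`.» (The companion requirement `α + α₋ > 2`, (15VIII16.1),
  is what makes centre of mass and angular momentum CONVERGE; Theorem 3.1 does not ask for it —
  removing it is the point of the paper, p0003:L21.)
* **Theorem 3.1** (p0006:L8–L19, verbatim): «Let `(𝒮, g, K)` be an `H^{-α}_ℓ`-AE initial data set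
  with `α ≥ 1/2`, `ℓ ≥ 4`, and timelike four-momentum. Assume that `(𝒮, g, K)` is vacuum at large
  distances. Suppose that either the initial data are time-symmetric, i.e. `K ≡ 0`, or the
  anti-parity exponent `α₋` in (29IV16.2) satisfies `α₋ > 1/2`. Then the vacuum maximal globally
  hyperbolic development of `(𝒮, g, K)` contains a [retarded foliation near `i⁰`], as defined in
  Section 1» — i.e. (p0003:L8–L9) «a foliation by null hypersurfaces `𝒩(u)` parameterised by
  `u ∈ (−∞, u₀]`, so that the hypersurfaces `𝒩(u)` intersect the asymptotically flat region of `𝒮` in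
  spheres which, to leading order, are coordinate spheres …, and which recede to infinity on `𝒮` as
  `u` tends to minus infinity … with the future-directed tangents to the generators of `𝒩(u)`
  pointing outwards … Finally, we will require that all generators of each `𝒩(u)` are complete to the
  future.» Abstract (p0002): «We prove completeness-to-the-future of null hypersurfaces emanating
  outwards from large spheres, in vacuum space-times evolving from general asymptotically flat data
  with well-defined energy-momentum. The proof uses scaling and a gluing construction to reduce the
  problem to Bieri's stability theorem.» Proof architecture (p0006:L21): «the proof has two
  components: the first is an interior gluing statement, the second a uniqueness-in-domains-of-
  dependence property of the evolution problem» (made explicit in the sister paper Bieri–Chruściel,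
  arXiv:1612.04359, proof of Thm. 6.1, p0012: «Uniqueness of solutions within domains of dependence
  guarantees that the space-time metric in the domain of dependence of `(ℝ³ ∖ B(4/ε), g, K)` within
  the space-time obtained by evolving `(𝒮, g, K)` will, after a constant rescaling of the space-time
  metric, be isometric to the domain of dependence of `(ℝ³, ĝ_ε, K̂_ε)` within `(𝓜, ⁴g_ε)`» — the
  latter being the geodesically complete small-data space-time of Bieri, JDG 86 (2010) [Bieri2010]).

## Dictionary (tree ↔ print) and paraphrase notes

Tree carriers: `AFEnd` (the end chart `x : {‖x‖ > R} → X`, components `hCoeff`, `kCoeff` as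
functions `E3 → (E3 →L E3 →L ℝ)`), `weightedSobolevSeminorm U s δ f =
(∑_{m ≤ s} ∫_U (1+‖x‖)^{2(δ+m)} ‖D^m f‖²)^{1/2}` (`WeightedNorms.lean`, Choquet-Bruhat–Christodoulou
orientation), `HasADMEnergy`/`HasADMMomentum` (`AsymptoticFlatness.lean`), `VacuumCauchyDevelopment`,
`.IsMaximal` (`CauchyDevelopment.lean`), `LorentzianMetric.IsNormalisedNullRayFrom`, `causalFuture`
(`NullInfinity.lean`, `Causality.lean`). With `q = 2` the printed weight
`(1+r)^{2(α+|γ|)} (1+r)^{-3}` is the tree's `(1+‖x‖)^{2(δ+m)}` for **`δ = α − 3/2`** (metric,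
`s = ℓ = 4`) and **`δ = (α+1) − 3/2 = α − 1/2`** (second fundamental form, `s = ℓ − 1 = 3`); operator
norms of the bilinear forms replace sums over components (equivalent seminorms, same finiteness).

* (α) DATA CLASS — special case of the print: ONE end which is the sole end of `X`
  (`AFEnd.IsSoleEnd`; print: compact ∪ finitely many ends), `ℓ = 4`, `α > 1/2` (print `α ≥ 1/2`),
  vacuum constraints and completeness on all of `X` (print: vacuum at large distances; an AE data set
  is complete, being a compact set plus complete ends), the Sobolev and parity conditions imposed on
  the chart region `{R' < ‖x‖}`, `R' ≥ e.R`, of the end chart (print: «there are coordinates in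
  which»), the parity bounds along `Bornology.cobounded E3` with `‖x‖` for `1 + r`, and the timelike
  four-momentum as «`(E, P)` exist in the chart `e` with `∑ Pᵢ² < E²` and `E > 0`» (future timelike;
  print: timelike). Stronger hypotheses, same conclusion.
* (β) DEVELOPMENT — «every maximal vacuum Cauchy development» for «the vacuum maximal globally
  hyperbolic development» (Choquet-Bruhat–Geroch uniqueness), as note (γ) of the companion.
* (γ) RAYS — printed is the future completeness of the GENERATORS of the leaves `𝒩(u)`, `u ≤ u₀`,
  of a retarded foliation covering the domain of dependence of the far region; typed, exactly as in
  the companion's note (δ), is the consequence form in the tree's sojourn vocabulary: a compact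
  `K ⊆ X` (the complement of the far region inside the innermost sphere `𝒩(u₀) ∩ 𝒮`) such that EVERY
  normalised future null ray from `X` that never enters `J⁺(ι K)` has affine domain unbounded above —
  such a ray lies in the domain of dependence of the far region, which by the proof (uniqueness in
  domains of dependence, quoted above) is isometric up to scaling to a domain of dependence in
  Bieri's geodesically complete space-time. A consequence of the printed proof, not a printed clause.

## Deliberately NOT here (and why): the Trautman–Bondi ledger

The work item also asks for «the Trautman–Bondi ledger along `𝒩(u)`»: Hawking masses of round
receding sections converging to `M_TB(u)`, `u ↦ M_TB(u)` non-increasing, `M_TB(u) ≤ m_ADM`,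
`M_TB(u) → m_ADM` as `u → −∞` (so that a cut of Bondi mass `≤ M` exists,
`CauchyDevelopment.HasCutBondiMass`). At the regularity of Theorem 3.1 this is NOT a theorem in
print: Chruściel 2017 only remarks (p0003:L40) «the resulting space-times have enough regularity to
define the radiation field, the Trautman-Bondi mass of the hypersurfaces `𝒩(u)`, and to show that the
Trautman-Bondi mass tends to the ADM mass when `u` tends to minus infinity. The reader is referred to
[ChBieri]», and in Bieri–Chruściel, arXiv:1612.04359: §8.2 (p0015:L150) «Let us SKETCH the proof,
that in the more general setting of spacetimes resulting from [small slowly decaying] initial data …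
the Trautman-Bondi mass `m(u)` for each null hypersurface `𝒩_u` is well-defined and finite»; the past
limit `lim_{u→−∞} m(u) = m_ADM` is Proposition 7.2 (p0013), CONDITIONAL on two convergence
hypotheses of a density argument about which the authors write «We expect the hypotheses of
Proposition 7.2 to be satisfied for a large class of space-times. It would be of interest to prove
precise statements to this effect.» A conditional/sketched statement is not Literature (it is an
obligation for `Summits/…/Theorems/`, planner's call); the Klainerman–Nicolò version of the ledger,
which IS printed (Ch. 8 of the book), is the tree's `klainerman_nicolo_exterior_bondi_ledger`.

One named fact; the corollaries `of_parity` (curried parity form), `of_timeSymmetric`,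
`of_mem_admissibleVacuumData` are PROVED. No `sorry`, no `instance`, no notation.

## References

* P. T. Chruściel, *Long time existence from interior gluing*, Class. Quantum Grav. 34 (2017)
  145016, arXiv:1612.04523: §1 (retarded foliation), §2 (classes, (29IV16.2)), Thm. 3.1 (p. 6).
  Bib key `Chrusciel2017`.
* L. Bieri, P. T. Chruściel, *Future-complete null hypersurfaces, interior gluings, and the
  Trautman–Bondi mass*, arXiv:1612.04359 (Harvard CMSA Nonlinear Equations program, 2016): Thm. 6.1
  and its proof (§6), Prop. 7.1–7.2 (§7), §8.2. Bib key `BieriChrusciel2016`.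
* L. Bieri, *An extension of the stability theorem of the Minkowski space in general relativity*,
  J. Differential Geom. 86 (2010) 17–70. Bib key `Bieri2010`.
* Y. Choquet-Bruhat, R. Geroch, CMP 14 (1969) (MGHD uniqueness; `VacuumCauchyDevelopment.IsMaximal`).
* Tree: `ExteriorStabilityNullCompleteness` (companion, conclusion currency), `WeightedNorms`
  (`weightedSobolevSeminorm`, the `δ` dictionary), `AsymptoticFlatness` (`AFEnd`, `hCoeff`, `kCoeff`,
  `HasADMEnergy`, `HasADMMomentum`, `IsSoleEnd`), `FinalState` (`admissibleVacuumData`),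
  `NullInfinity` (`IsNormalisedNullRayFrom`).
-/

noncomputable section

open Set Filter Topology Asymptotics Bornology
open scoped Manifold ContDiff ENNReal

namespace Literature.Geometry.Lorentzian

/-- **Chruściel 2017, Thm. 3.1: the far exterior of `H^{-α}_4`-asymptotically Euclidean vacuum data
with timelike four-momentum is future null complete** (named fact, Cauchy consequence form; NO
smallness, NO maximality). For every connected Hausdorff second-countable smooth `3`-manifold `X`;
every smooth initial data set `D = (h, k)` on `X` solving the vacuum constraints and complete
(standing `[D.metric.HasLeviCivita]` bound inside); every end chart `e` which is the sole end of `X`,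
every `α > 1/2` and `R' ≥ e.R` with, on the chart region `{R' < ‖x‖}`,
`h − δ ∈ H^{-α}_4` (`weightedSobolevSeminorm _ 4 (α − 3/2) (h − δ) < ∞`) and `k ∈ H^{-α-1}_3`
(`weightedSobolevSeminorm _ 3 (α − 1/2) k < ∞`); EITHER `k = 0` there (time-symmetric) OR the parity
condition (29IV16.2) with some anti-parity exponent `α₋ > 1/2`
(`|h(x) − h(−x)| = O(|x|^{-α₋})`, `|x| |∂(h(x) − h(−x))| = O(|x|^{-α₋})`,
`|k(x) + k(−x)| = O(|x|^{-1-α₋})`); and future-timelike ADM four-momentum in the chart `e`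
(`(E, P)` exist, `∑ Pᵢ² < E²`, `E > 0`): in every maximal vacuum Cauchy development `𝒟` of `D` there
is a compact `K ⊆ X` such that every normalised future null ray `γ` from a point of `X`
(`IsNormalisedNullRayFrom`, affine domain `dom ∋ 0`) with `γ t ∉ J⁺(ι '' K)` for all `t ≥ 0` in `dom`
has `dom` unbounded above. Print: the MGHD «contains a retarded foliation near `i⁰`» by outgoing null
hypersurfaces `𝒩(u)`, `u ≤ u₀`, all of whose generators are future complete; paraphrase notes
(α)–(γ) in the module docstring (special-case hypotheses; every MGHD; all `J⁺(ι K)`-avoiding rays as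
the consequence of the proof by uniqueness in domains of dependence + Bieri 2010).
[cite: Chrusciel2017, Thm. 3.1 (p. 6); §1; §2 (29IV16.2)] [cite: BieriChrusciel2016, Thm. 6.1 (proof)]
[cite: Bieri2010, main theorem] -/
def chrusciel2017_future_complete_null_hypersurfaces : Prop :=
  ∀ (X : Type) [TopologicalSpace X] [ChartedSpace E3 X] [IsManifold (𝓡 3) ∞ X] [T2Space X]
    [SecondCountableTopology X] [ConnectedSpace X] (D : InitialDataSet (𝓡 3) X),
    (∀ [D.metric.HasLeviCivita], D.IsVacuumConstraintSolution ∧ D.IsComplete) →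
    ∀ (e : AFEnd X) (α R' : ℝ), 1 / 2 < α → e.R ≤ R' → e.IsSoleEnd →
      weightedSobolevSeminorm {x : E3 | R' < ‖x‖} 4 (α - 3 / 2)
          (fun x ↦ e.hCoeff D x - (innerSL ℝ : E3 →L[ℝ] E3 →L[ℝ] ℝ)) < ⊤ →
      weightedSobolevSeminorm {x : E3 | R' < ‖x‖} 3 (α - 1 / 2) (fun x ↦ e.kCoeff D x) < ⊤ →
      ((∀ x : E3, R' < ‖x‖ → e.kCoeff D x = 0) ∨
        ∃ αm : ℝ, 1 / 2 < αm ∧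
          (fun x : E3 ↦ ‖e.hCoeff D x - e.hCoeff D (-x)‖) =O[cobounded E3] (fun x ↦ ‖x‖ ^ (-αm)) ∧
          (fun x : E3 ↦ ‖x‖ * ‖iteratedFDeriv ℝ 1 (fun y ↦ e.hCoeff D y - e.hCoeff D (-y)) x‖)
              =O[cobounded E3] (fun x ↦ ‖x‖ ^ (-αm)) ∧
          (fun x : E3 ↦ ‖e.kCoeff D x + e.kCoeff D (-x)‖) =O[cobounded E3]
              (fun x ↦ ‖x‖ ^ (-1 - αm))) →
      (∃ (E : ℝ) (P : Fin 3 → ℝ), e.HasADMEnergy D E ∧ (∀ i, e.HasADMMomentum D i (P i)) ∧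
          ∑ i, P i ^ 2 < E ^ 2 ∧ 0 < E) →
    ∀ 𝒟 : VacuumCauchyDevelopment D, 𝒟.IsMaximal → ∀ [𝒟.metric.HasLeviCivita],
      ∃ K : Set X, IsCompact K ∧ ∀ (p : X) (γ : ℝ → 𝒟.carrier) (dom : Set ℝ),
        𝒟.metric.IsNormalisedNullRayFrom 𝒟.timeOrientation 𝒟.embed 𝒟.normal p γ dom →
        (∀ t ∈ dom, 0 ≤ t → γ t ∉ 𝒟.metric.causalFuture 𝒟.timeOrientation (𝒟.embed '' K)) →
        ¬ BddAbove dom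

namespace chrusciel2017_future_complete_null_hypersurfaces

variable {X : Type} [TopologicalSpace X] [ChartedSpace E3 X] [IsManifold (𝓡 3) ∞ X]
  [T2Space X] [SecondCountableTopology X] [ConnectedSpace X]

/-- **The parity case, curried** (the shape in which the `decomp-fsc` cell consumes it: an explicit
anti-parity exponent `αm > 1/2` and the three parity bounds as separate hypotheses). Chruściel 2017,
Thm. 3.1, second alternative. [cite: Chrusciel2017, Thm. 3.1 (p. 6); §2 (29IV16.2)] -/
theorem of_parity (h : chrusciel2017_future_complete_null_hypersurfaces)
    {D : InitialDataSet (𝓡 3) X}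
    (hD : ∀ [D.metric.HasLeviCivita], D.IsVacuumConstraintSolution ∧ D.IsComplete)
    (e : AFEnd X) {α αm R' : ℝ} (hα : 1 / 2 < α) (hαm : 1 / 2 < αm) (hR' : e.R ≤ R')
    (hsole : e.IsSoleEnd)
    (hh : weightedSobolevSeminorm {x : E3 | R' < ‖x‖} 4 (α - 3 / 2)
      (fun x ↦ e.hCoeff D x - (innerSL ℝ : E3 →L[ℝ] E3 →L[ℝ] ℝ)) < ⊤)
    (hk : weightedSobolevSeminorm {x : E3 | R' < ‖x‖} 3 (α - 1 / 2) (fun x ↦ e.kCoeff D x) < ⊤)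
    (hp₀ : (fun x : E3 ↦ ‖e.hCoeff D x - e.hCoeff D (-x)‖) =O[cobounded E3] (fun x ↦ ‖x‖ ^ (-αm)))
    (hp₁ : (fun x : E3 ↦ ‖x‖ * ‖iteratedFDeriv ℝ 1 (fun y ↦ e.hCoeff D y - e.hCoeff D (-y)) x‖)
      =O[cobounded E3] (fun x ↦ ‖x‖ ^ (-αm)))
    (hpk : (fun x : E3 ↦ ‖e.kCoeff D x + e.kCoeff D (-x)‖) =O[cobounded E3]
      (fun x ↦ ‖x‖ ^ (-1 - αm)))
    (hmom : ∃ (E : ℝ) (P : Fin 3 → ℝ), e.HasADMEnergy D E ∧ (∀ i, e.HasADMMomentum D i (P i)) ∧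
      ∑ i, P i ^ 2 < E ^ 2 ∧ 0 < E)
    (𝒟 : VacuumCauchyDevelopment D) (h𝒟 : 𝒟.IsMaximal) [𝒟.metric.HasLeviCivita] :
    ∃ K : Set X, IsCompact K ∧ ∀ (p : X) (γ : ℝ → 𝒟.carrier) (dom : Set ℝ),
      𝒟.metric.IsNormalisedNullRayFrom 𝒟.timeOrientation 𝒟.embed 𝒟.normal p γ dom →
      (∀ t ∈ dom, 0 ≤ t → γ t ∉ 𝒟.metric.causalFuture 𝒟.timeOrientation (𝒟.embed '' K)) →
      ¬ BddAbove dom :=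
  h X D hD e α R' hα hR' hsole hh hk (Or.inr ⟨αm, hαm, hp₀, hp₁, hpk⟩) hmom 𝒟 h𝒟

/-- **The time-symmetric case** `k = 0` beyond `R'` (no parity hypothesis; «the assumptions in the
time-symmetric case appear to be optimal with respect to the definition of total mass»). Chruściel
2017, Thm. 3.1, first alternative. [cite: Chrusciel2017, Thm. 3.1 (p. 6)] -/
theorem of_timeSymmetric (h : chrusciel2017_future_complete_null_hypersurfaces)
    {D : InitialDataSet (𝓡 3) X}
    (hD : ∀ [D.metric.HasLeviCivita], D.IsVacuumConstraintSolution ∧ D.IsComplete)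
    (e : AFEnd X) {α R' : ℝ} (hα : 1 / 2 < α) (hR' : e.R ≤ R') (hsole : e.IsSoleEnd)
    (hh : weightedSobolevSeminorm {x : E3 | R' < ‖x‖} 4 (α - 3 / 2)
      (fun x ↦ e.hCoeff D x - (innerSL ℝ : E3 →L[ℝ] E3 →L[ℝ] ℝ)) < ⊤)
    (hk0 : ∀ x : E3, R' < ‖x‖ → e.kCoeff D x = 0)
    (hmom : ∃ (E : ℝ) (P : Fin 3 → ℝ), e.HasADMEnergy D E ∧ (∀ i, e.HasADMMomentum D i (P i)) ∧
      ∑ i, P i ^ 2 < E ^ 2 ∧ 0 < E)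
    (𝒟 : VacuumCauchyDevelopment D) (h𝒟 : 𝒟.IsMaximal) [𝒟.metric.HasLeviCivita] :
    ∃ K : Set X, IsCompact K ∧ ∀ (p : X) (γ : ℝ → 𝒟.carrier) (dom : Set ℝ),
      𝒟.metric.IsNormalisedNullRayFrom 𝒟.timeOrientation 𝒟.embed 𝒟.normal p γ dom →
      (∀ t ∈ dom, 0 ≤ t → γ t ∉ 𝒟.metric.causalFuture 𝒟.timeOrientation (𝒟.embed '' K)) →
      ¬ BddAbove dom := by
  refine h X D hD e α R' hα hR' hsole hh ?_ (Or.inl hk0) hmom 𝒟 h𝒟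
  -- `k = 0` on the open far region, so every `D^m k` vanishes there and the seminorm is `0`
  have hopen : IsOpen {x : E3 | R' < ‖x‖} := isOpen_lt continuous_const continuous_norm
  have hzero : ∀ m : ℕ, ∀ x ∈ {x : E3 | R' < ‖x‖},
      iteratedFDeriv ℝ m (fun x ↦ e.kCoeff D x) x = iteratedFDeriv ℝ m (0 : E3 → _) x := by
    intro m x hx
    have hev : (fun y ↦ e.kCoeff D y) =ᶠ[𝓝 x] (0 : E3 → E3 →L[ℝ] E3 →L[ℝ] ℝ) :=
      Filter.eventuallyEq_of_mem (hopen.mem_nhds hx) fun y hy ↦ hk0 y hy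
    exact (hev.iteratedFDeriv ℝ m).eq_of_nhds
  have : weightedSobolevSeminorm {x : E3 | R' < ‖x‖} 3 (α - 1 / 2) (fun x ↦ e.kCoeff D x) =
      weightedSobolevSeminorm {x : E3 | R' < ‖x‖} 3 (α - 1 / 2) (0 : E3 → E3 →L[ℝ] E3 →L[ℝ] ℝ) := by
    unfold weightedSobolevSeminorm
    congr 1
    refine Finset.sum_congr rfl fun m _ ↦ MeasureTheory.setLIntegral_congr_fun
      hopen.measurableSet (fun x hx ↦ by rw [hzero m x hx])
  rw [this, weightedSobolevSeminorm_zero]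
  exact ENNReal.zero_lt_top

/-- **For Christodoulou-admissible data** (`admissibleVacuumData`: vacuum constraints and
completeness are part of admissibility) which ALSO lie in Chruściel's class on a sole end chart `e`
(parity form). [cite: Chrusciel2017, Thm. 3.1 (p. 6)] [cite: Christodoulou1999, p. A24] -/
theorem of_mem_admissibleVacuumData (h : chrusciel2017_future_complete_null_hypersurfaces)
    {D : InitialDataSet (𝓡 3) X} (hD : D ∈ admissibleVacuumData X)
    (e : AFEnd X) {α αm R' : ℝ} (hα : 1 / 2 < α) (hαm : 1 / 2 < αm) (hR' : e.R ≤ R')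
    (hsole : e.IsSoleEnd)
    (hh : weightedSobolevSeminorm {x : E3 | R' < ‖x‖} 4 (α - 3 / 2)
      (fun x ↦ e.hCoeff D x - (innerSL ℝ : E3 →L[ℝ] E3 →L[ℝ] ℝ)) < ⊤)
    (hk : weightedSobolevSeminorm {x : E3 | R' < ‖x‖} 3 (α - 1 / 2) (fun x ↦ e.kCoeff D x) < ⊤)
    (hp₀ : (fun x : E3 ↦ ‖e.hCoeff D x - e.hCoeff D (-x)‖) =O[cobounded E3] (fun x ↦ ‖x‖ ^ (-αm)))
    (hp₁ : (fun x : E3 ↦ ‖x‖ * ‖iteratedFDeriv ℝ 1 (fun y ↦ e.hCoeff D y - e.hCoeff D (-y)) x‖)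
      =O[cobounded E3] (fun x ↦ ‖x‖ ^ (-αm)))
    (hpk : (fun x : E3 ↦ ‖e.kCoeff D x + e.kCoeff D (-x)‖) =O[cobounded E3]
      (fun x ↦ ‖x‖ ^ (-1 - αm)))
    (hmom : ∃ (E : ℝ) (P : Fin 3 → ℝ), e.HasADMEnergy D E ∧ (∀ i, e.HasADMMomentum D i (P i)) ∧
      ∑ i, P i ^ 2 < E ^ 2 ∧ 0 < E)
    (𝒟 : VacuumCauchyDevelopment D) (h𝒟 : 𝒟.IsMaximal) [𝒟.metric.HasLeviCivita] :
    ∃ K : Set X, IsCompact K ∧ ∀ (p : X) (γ : ℝ → 𝒟.carrier) (dom : Set ℝ),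
      𝒟.metric.IsNormalisedNullRayFrom 𝒟.timeOrientation 𝒟.embed 𝒟.normal p γ dom →
      (∀ t ∈ dom, 0 ≤ t → γ t ∉ 𝒟.metric.causalFuture 𝒟.timeOrientation (𝒟.embed '' K)) →
      ¬ BddAbove dom :=
  of_parity h hD.1 e hα hαm hR' hsole hh hk hp₀ hp₁ hpk hmom 𝒟 h𝒟

end chrusciel2017_future_complete_null_hypersurfaces

end Literature.Geometry.Lorentzian
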